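import Literature.NumberTheory.EllipticCurves.JacobiThetaDerivativeFormula
import HarnessLib

/-!
# Jacobi's quartic identity `θ₃⁴ = θ₂⁴ + θ₄⁴` and the thetanulls on the imaginary axis

Two classical complements to `JacobiThetaDerivativeFormula.lean` (same thetanulls
`theta2`, `theta3`, `theta4` built from Mathlib's `jacobiTheta₂`), both PROVED:

* **Jacobi's quartic identity** (the *aequatio identica satis abstrusa*, Jacobi 1829;
  Whittaker–Watson §21.2; Lawden §1.6): `theta3 τ ^ 4 = theta2 τ ^ 4 + theta4 τ ^ 4` for every
  `τ : ℂ` (both sides vanish off the upper half-plane by Mathlib's junk-value convention).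
  Proof (modular, level one): the defect `Q = θ₃⁴ - θ₂⁴ - θ₄⁴` satisfies `Q(τ+1) = -Q(τ)`,
  `Q(-1/τ) = -τ² Q(τ)`, is holomorphic on `ℍ` and tends to `0` at `i∞`; hence `Q²` is a level-one
  cusp form of weight `4`, and `S₄(SL₂(ℤ)) = 0` (Mathlib's
  `CuspForm.rank_eq_zero_of_weight_lt_twelve`).
* **Values on the positive imaginary axis**: for `y > 0`, `θ₂(iy)`, `θ₃(iy)`, `θ₄(iy)` are real and
  positive (`θ₂`, `θ₃` termwise from the series; `θ₄(iy) = y^{-1/2} θ₂(i/y)` by the `S`-law), hence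
  so is `P(iy) = θ₂θ₃θ₄(iy)`, and `0 < θ₂(iy)⁴/θ₃(iy)⁴ < 1` (the elliptic modulus `λ(iy)`).

These feed the Kleban–Zagier crossing-probability theorem
(`Literature/Probability/RandomPlanarGeometry/KlebanZagierCrossing*.lean`).

## References

* E. T. Whittaker, G. N. Watson, *A Course of Modern Analysis*, 4th ed. (1927), §21.2, §21.41.
* D. F. Lawden, *Elliptic Functions and Applications*, Springer (1989), §1.6. [Lawden1989]
-/

noncomputable section

open Complex Real Filter Topology Asymptotics

open scoped Real

namespace Literature.NumberTheory.EllipticCurves.JacobiThetaNull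

/-! ### A level-one cusp form of weight `< 12` given by a function on `ℂ` vanishes -/

section Vanishing

open UpperHalfPlane ModularForm SlashInvariantForm CongruenceSubgroup

open scoped MatrixGroups ModularForm

/-- If `g : ℂ → ℂ` satisfies `g(τ+1) = g(τ)` and `g(-1/τ) = τᵏ g(τ)` on `ℍ` (`k < 12`), is
holomorphic on `ℍ` and tends to `0` at `i∞`, then `g = 0` on `ℍ`: it defines a level-one cusp form
of weight `k < 12`, and that space is zero (Mathlib's dimension formula). [folklore] -/
theorem eq_zero_of_cuspForm_weight_lt_twelve (k : ℕ) (hk : (k : ℤ) < 12) (g : ℂ → ℂ)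
    (hT : ∀ τ : ℂ, g (τ + 1) = g τ)
    (hS : ∀ τ : ℂ, 0 < im τ → g (-1 / τ) = τ ^ k * g τ)
    (hhol : ∀ τ : ℂ, 0 < im τ → DifferentiableAt ℂ g τ)
    (hzero : Tendsto g (comap im atTop) (𝓝 0)) {τ : ℂ} (hτ : 0 < im τ) : g τ = 0 := by
  have hS' : (fun τ : ℍ ↦ g τ) ∣[(k : ℤ)] ModularGroup.S = fun τ : ℍ ↦ g τ := by
    ext z
    rw [slash_S_apply]
    have hz : 0 < im (z : ℂ) := z.2
    have hz0 : (z : ℂ) ≠ 0 := ne_zero_of_im_pos hz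
    change g (-(z : ℂ))⁻¹ * (z : ℂ) ^ (-(k : ℤ)) = g z
    rw [inv_neg, ← one_div, ← neg_div, hS z hz, zpow_neg, zpow_natCast]
    field_simp
  have hT' : (fun τ : ℍ ↦ g τ) ∣[(k : ℤ)] ModularGroup.T = fun τ : ℍ ↦ g τ := by
    ext z
    rw [SL_slash_apply, modular_T_smul, UpperHalfPlane.coe_vadd]
    simp only [ModularGroup.T, denom]
    push_cast
    rw [add_comm, hT]
    simp
  let F : CuspForm 𝒮ℒ (k : ℤ) :=
    { toFun := fun τ : ℍ ↦ g τ
      slash_action_eq' := fun A hA ↦ by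
        obtain ⟨A, rfl⟩ := hA
        exact slash_action_generators_SL2Z hS' hT' A
      holo' := by
        rw [UpperHalfPlane.mdifferentiable_iff]
        have h1 : DifferentiableOn ℂ g {z : ℂ | 0 < z.im} :=
          fun z hz ↦ (hhol z hz).differentiableWithinAt
        refine h1.congr fun z hz ↦ ?_
        simp [ofComplex_apply_of_im_pos hz]
      zero_at_cusps' := fun {c} hc ↦ by
        rw [Subgroup.IsArithmetic.isCusp_iff_isCusp_SL2Z] at hc
        rw [OnePoint.isZeroAt_iff_forall_SL2Z hc]
        intro γ _
        rw [slash_action_generators_SL2Z hS' hT']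
        exact hzero.comp tendsto_coe_atImInfty }
  have hF : F = 0 := rank_zero_iff_forall_zero.mp (CuspForm.rank_eq_zero_of_weight_lt_twelve hk) F
  have := congrArg (fun G : CuspForm 𝒮ℒ (k : ℤ) ↦ G ⟨τ, hτ⟩) hF
  exact this

end Vanishing

/-! ### The defect `Q = θ₃⁴ - θ₂⁴ - θ₄⁴` -/

/-- `(e^{πi/4})⁴ = -1`. [folklore] -/
theorem exp_pi_I_div_four_pow_four : cexp (π * I / 4) ^ 4 = -1 := by
  rw [← Complex.exp_nat_mul, show ((4 : ℕ) : ℂ) * (π * I / 4) = π * I by push_cast; ring,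
    Complex.exp_pi_mul_I]

/-- `((-iτ)^{1/2})⁴ = -τ²`. [folklore] -/
theorem cpow_half_pow_four (τ : ℂ) : ((-I * τ) ^ (1 / 2 : ℂ)) ^ 4 = -τ ^ 2 := by
  rw [show 4 = 2 * 2 from rfl, pow_mul, cpow_half_sq, mul_pow, neg_pow, I_sq]
  ring

/-- `Q(τ + 1) = -Q(τ)` for the quartic defect. [folklore] -/
theorem quarticDefect_add_one (τ : ℂ) :
    theta3 (τ + 1) ^ 4 - theta2 (τ + 1) ^ 4 - theta4 (τ + 1) ^ 4 =
      -(theta3 τ ^ 4 - theta2 τ ^ 4 - theta4 τ ^ 4) := by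
  rw [theta3_add_one, theta2_add_one, theta4_add_one, mul_pow, exp_pi_I_div_four_pow_four]
  ring

/-- `Q(-1/τ) = -τ² Q(τ)` for the quartic defect. [folklore] -/
theorem quarticDefect_neg_one_div {τ : ℂ} (hτ : 0 < im τ) :
    theta3 (-1 / τ) ^ 4 - theta2 (-1 / τ) ^ 4 - theta4 (-1 / τ) ^ 4 =
      -τ ^ 2 * (theta3 τ ^ 4 - theta2 τ ^ 4 - theta4 τ ^ 4) := by
  rw [theta3_neg_one_div hτ, theta2_neg_one_div hτ, theta4_neg_one_div hτ, mul_pow, mul_pow,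
    mul_pow, cpow_half_pow_four]
  ring

/-- `θ₂ → 0` at `i∞`. [folklore] -/
theorem tendsto_theta2_zero : Tendsto theta2 (comap im atTop) (𝓝 0) := by
  have := tendsto_exp_quarter.mul tendsto_theta2
  rw [zero_mul] at this
  refine this.congr fun τ ↦ ?_
  rw [← mul_assoc, ← Complex.exp_add, add_neg_cancel, Complex.exp_zero, one_mul]

/-- `Q → 0` at `i∞` (`θ₃, θ₄ → 1`, `θ₂ → 0`). [folklore] -/
theorem tendsto_quarticDefect :
    Tendsto (fun τ : ℂ ↦ theta3 τ ^ 4 - theta2 τ ^ 4 - theta4 τ ^ 4) (comap im atTop) (𝓝 0) := by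
  have := ((tendsto_theta3.pow 4).sub (tendsto_theta2_zero.pow 4)).sub (tendsto_theta4.pow 4)
  simpa using this

/-- **Jacobi's quartic identity** `θ₃(τ)⁴ = θ₂(τ)⁴ + θ₄(τ)⁴` (Jacobi 1829; Whittaker–Watson
§21.2), for every `τ : ℂ` (trivial off `ℍ`). Proof: the square of the defect is a level-one cusp
form of weight `4`, hence zero. [cite: Lawden1989, §1.6] -/
theorem theta3_pow_four (τ : ℂ) : theta3 τ ^ 4 = theta2 τ ^ 4 + theta4 τ ^ 4 := by
  by_cases hτ : 0 < im τ
  · have key := eq_zero_of_cuspForm_weight_lt_twelve 4 (by norm_num)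
      (fun τ ↦ (theta3 τ ^ 4 - theta2 τ ^ 4 - theta4 τ ^ 4) ^ 2)
      (fun τ ↦ by simp only [quarticDefect_add_one, neg_sq])
      (fun τ hτ ↦ by rw [quarticDefect_neg_one_div hτ]; ring)
      (fun τ hτ ↦ ((((differentiableAt_theta3 hτ).pow 4).sub ((differentiableAt_theta2 hτ).pow 4)).sub
        ((differentiableAt_theta4 hτ).pow 4)).pow 2)
      (by simpa using tendsto_quarticDefect.pow 2) hτ
    have := pow_eq_zero_iff (n := 2) (by norm_num) |>.mp key
    linear_combination this
  · have hτ' : im τ ≤ 0 := not_lt.mp hτ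
    have h2 : theta2 τ = 0 := by
      rw [theta2, jacobiTheta₂_undef _ hτ', mul_zero]
    have h3 : theta3 τ = 0 := by rw [theta3, jacobiTheta₂_undef _ hτ']
    have h4 : theta4 τ = 0 := by rw [theta4, jacobiTheta₂_undef _ hτ']
    simp [h2, h3, h4]

/-! ### The thetanulls on the positive imaginary axis -/

section Axis

variable {y : ℝ}

/-- `Im(iy) = y`. [folklore] -/
theorem im_I_mul_ofReal (y : ℝ) : im (I * y) = y := by simp

/-- `iy ∈ ℍ` for `y > 0`. [folklore] -/
theorem im_I_mul_pos (hy : 0 < y) : 0 < im (I * y) := by simpa using hy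

/-- `θ₃(iy) = ∑ₙ e^{-πn²y}` as a series of real numbers. [folklore] -/
theorem hasSum_theta3_I_mul (hy : 0 < y) :
    HasSum (fun n : ℤ ↦ ((rexp (-π * (n : ℝ) ^ 2 * y) : ℝ) : ℂ)) (theta3 (I * y)) := by
  have h := hasSum_jacobiTheta₂_term 0 (im_I_mul_pos hy)
  have e : (fun n : ℤ ↦ ((rexp (-π * (n : ℝ) ^ 2 * y) : ℝ) : ℂ)) =
      fun n : ℤ ↦ jacobiTheta₂_term n 0 (I * y) := by
    funext n
    rw [jacobiTheta₂_term, Complex.ofReal_exp]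
    congr 1
    push_cast
    linear_combination (-(↑π * (n : ℂ) ^ 2 * (y : ℂ))) * I_mul_I
  rw [e]
  exact h

/-- `θ₂(iy) = ∑ₙ e^{-π(n+½)²y}` as a series of real numbers. [folklore] -/
theorem hasSum_theta2_I_mul (hy : 0 < y) :
    HasSum (fun n : ℤ ↦ ((rexp (-π * ((n : ℝ) ^ 2 + n + 1 / 4) * y) : ℝ) : ℂ)) (theta2 (I * y)) := by
  have h := (hasSum_jacobiTheta₂_term (I * y / 2) (im_I_mul_pos hy)).mul_left
    (cexp (π * I * (I * y) / 4))
  have e : (fun n : ℤ ↦ ((rexp (-π * ((n : ℝ) ^ 2 + n + 1 / 4) * y) : ℝ) : ℂ)) =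
      fun n : ℤ ↦ cexp (π * I * (I * y) / 4) * jacobiTheta₂_term n (I * y / 2) (I * y) := by
    funext n
    rw [jacobiTheta₂_term, ← Complex.exp_add, Complex.ofReal_exp]
    congr 1
    push_cast
    linear_combination (-(↑π * (y : ℂ) * ((n : ℂ) ^ 2 + n + 1 / 4))) * I_mul_I
  rw [e]
  exact h

/-- The real series for `θ₃(iy)` is summable. [folklore] -/
theorem summable_theta3_I_mul (hy : 0 < y) : Summable fun n : ℤ ↦ rexp (-π * (n : ℝ) ^ 2 * y) :=
  (Complex.summable_ofReal).mp (hasSum_theta3_I_mul hy).summable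

/-- The real series for `θ₂(iy)` is summable. [folklore] -/
theorem summable_theta2_I_mul (hy : 0 < y) :
    Summable fun n : ℤ ↦ rexp (-π * ((n : ℝ) ^ 2 + n + 1 / 4) * y) :=
  (Complex.summable_ofReal).mp (hasSum_theta2_I_mul hy).summable

/-- **`θ₃(iy)` is the positive real number `∑ₙ e^{-πn²y}`.** [folklore] -/
theorem theta3_I_mul (hy : 0 < y) :
    theta3 (I * y) = ((∑' n : ℤ, rexp (-π * (n : ℝ) ^ 2 * y) : ℝ) : ℂ) := by
  rw [Complex.ofReal_tsum, (hasSum_theta3_I_mul hy).tsum_eq]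

/-- **`θ₂(iy)` is the positive real number `∑ₙ e^{-π(n+½)²y}`.** [folklore] -/
theorem theta2_I_mul (hy : 0 < y) :
    theta2 (I * y) = ((∑' n : ℤ, rexp (-π * ((n : ℝ) ^ 2 + n + 1 / 4) * y) : ℝ) : ℂ) := by
  rw [Complex.ofReal_tsum, (hasSum_theta2_I_mul hy).tsum_eq]

/-- `θ₃(iy) > 0` (as the real part; the imaginary part vanishes). [folklore] -/
theorem theta3_I_mul_re_pos (hy : 0 < y) : 0 < (theta3 (I * y)).re := by
  rw [theta3_I_mul hy, ofReal_re]
  exact (summable_theta3_I_mul hy).tsum_pos (fun n ↦ (Real.exp_pos _).le) 0 (Real.exp_pos _)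

/-- `θ₂(iy) > 0`. [folklore] -/
theorem theta2_I_mul_re_pos (hy : 0 < y) : 0 < (theta2 (I * y)).re := by
  rw [theta2_I_mul hy, ofReal_re]
  exact (summable_theta2_I_mul hy).tsum_pos (fun n ↦ (Real.exp_pos _).le) 0 (Real.exp_pos _)

/-- `θ₃(iy)` is real. [folklore] -/
theorem theta3_I_mul_eq_re (hy : 0 < y) : theta3 (I * y) = ((theta3 (I * y)).re : ℂ) := by
  rw [theta3_I_mul hy, ofReal_re]

/-- `θ₂(iy)` is real. [folklore] -/
theorem theta2_I_mul_eq_re (hy : 0 < y) : theta2 (I * y) = ((theta2 (I * y)).re : ℂ) := by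
  rw [theta2_I_mul hy, ofReal_re]

/-- `-1/(iy) = i/y`. [folklore] -/
theorem neg_one_div_I_mul (hy : 0 < y) : (-1 / (I * y) : ℂ) = I * (y⁻¹ : ℝ) := by
  have hy0 : (y : ℂ) ≠ 0 := ofReal_ne_zero.mpr hy.ne'
  field_simp
  push_cast
  field_simp
  linear_combination (-1 : ℂ) * I_mul_I

/-- `(-i·iy)^{1/2} = y^{1/2}`. [folklore] -/
theorem cpow_half_I_mul (hy : 0 < y) : (-I * (I * y)) ^ (1 / 2 : ℂ) = ((y ^ (1 / 2 : ℝ) : ℝ) : ℂ) := by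
  rw [show (-I * (I * y) : ℂ) = y by linear_combination (-(y : ℂ)) * I_mul_I,
    show (1 / 2 : ℂ) = ((1 / 2 : ℝ) : ℂ) by push_cast; ring, ← Complex.ofReal_cpow hy.le]

/-- **The `S`-law on the axis: `θ₄(iy) = y^{-1/2} θ₂(i/y)`.** [folklore] -/
theorem theta4_I_mul (hy : 0 < y) :
    theta4 (I * y) = ((y ^ (-(1 / 2 : ℝ)) : ℝ) : ℂ) * theta2 (I * (y⁻¹ : ℝ)) := by
  have h := theta2_neg_one_div (im_I_mul_pos hy)
  rw [neg_one_div_I_mul hy, cpow_half_I_mul hy] at h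
  rw [h, ← mul_assoc, ← Complex.ofReal_mul, ← Real.rpow_add hy, show -(1 / 2 : ℝ) + 1 / 2 = 0 by ring,
    Real.rpow_zero, Complex.ofReal_one, one_mul]

/-- `θ₄(iy)` is real. [folklore] -/
theorem theta4_I_mul_eq_re (hy : 0 < y) : theta4 (I * y) = ((theta4 (I * y)).re : ℂ) := by
  rw [theta4_I_mul hy, theta2_I_mul_eq_re (inv_pos.mpr hy), ← Complex.ofReal_mul, ofReal_re]

/-- `θ₄(iy) > 0`. [folklore] -/
theorem theta4_I_mul_re_pos (hy : 0 < y) : 0 < (theta4 (I * y)).re := by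
  rw [theta4_I_mul hy, theta2_I_mul_eq_re (inv_pos.mpr hy), ← Complex.ofReal_mul, ofReal_re]
  exact mul_pos (Real.rpow_pos_of_pos hy _) (theta2_I_mul_re_pos (inv_pos.mpr hy))

/-- `P(iy) = θ₂θ₃θ₄(iy)` is real. [folklore] -/
theorem thetaP_I_mul_eq_re (hy : 0 < y) : thetaP (I * y) = ((thetaP (I * y)).re : ℂ) := by
  conv_lhs => rw [thetaP, theta2_I_mul_eq_re hy, theta3_I_mul_eq_re hy, theta4_I_mul_eq_re hy]
  conv_rhs => rw [thetaP, theta2_I_mul_eq_re hy, theta3_I_mul_eq_re hy, theta4_I_mul_eq_re hy]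
  simp only [← Complex.ofReal_mul, ofReal_re]

/-- `P(iy) > 0`. [folklore] -/
theorem thetaP_I_mul_re_pos (hy : 0 < y) : 0 < (thetaP (I * y)).re := by
  rw [thetaP, theta2_I_mul_eq_re hy, theta3_I_mul_eq_re hy, theta4_I_mul_eq_re hy,
    ← Complex.ofReal_mul, ← Complex.ofReal_mul, ofReal_re]
  exact mul_pos (mul_pos (theta2_I_mul_re_pos hy) (theta3_I_mul_re_pos hy)) (theta4_I_mul_re_pos hy)

/-- **Jacobi's quartic identity on the axis**, real form: `θ₃(iy)⁴ = θ₂(iy)⁴ + θ₄(iy)⁴` for the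
(positive real) values. [cite: Lawden1989, §1.6] -/
theorem theta3_I_mul_re_pow_four (hy : 0 < y) :
    (theta3 (I * y)).re ^ 4 = (theta2 (I * y)).re ^ 4 + (theta4 (I * y)).re ^ 4 := by
  have h := theta3_pow_four (I * y)
  rw [theta3_I_mul_eq_re hy, theta2_I_mul_eq_re hy, theta4_I_mul_eq_re hy] at h
  exact_mod_cast h

/-- **The elliptic modulus on the axis lies in `(0, 1)`**: `0 < θ₂(iy)⁴/θ₃(iy)⁴ < 1`. [folklore] -/
theorem theta2_div_theta3_pow_four_mem_Ioo (hy : 0 < y) :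
    (theta2 (I * y)).re ^ 4 / (theta3 (I * y)).re ^ 4 ∈ Set.Ioo (0 : ℝ) 1 := by
  have h2 := pow_pos (theta2_I_mul_re_pos hy) 4
  have h3 := pow_pos (theta3_I_mul_re_pos hy) 4
  have h4 := pow_pos (theta4_I_mul_re_pos hy) 4
  have hq := theta3_I_mul_re_pow_four hy
  refine ⟨div_pos h2 h3, ?_⟩
  rw [div_lt_one h3]
  linarith

end Axis

end Literature.NumberTheory.EllipticCurves.JacobiThetaNull
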